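import Mathlib
import Summits.ValiantsHypothesis.ValiantsHypothesis.Theses.FreeSubtorus
import Summits.ValiantsHypothesis.ValiantsHypothesis.Theorems.FreeSubtorusSubtorusCovering
import Summits.ValiantsHypothesis.ValiantsHypothesis.Cruxes.OrbitDimensionBound.Lines.DepthLadder

/-!
# `filtered_covering_special` — F3 / BC5: the rung family SPECIALISES to the proved floor (kernel-checked, no sorry)

Family `Depth.DepthCovering q` (degeneration depth `q : ℕ∞`), rung `FilteredCovering = DepthCovering 1` / filed shadow
`FilteredShadow = DepthShadow 1`, floor parameter `q = 0`.  Witness = the seed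
`Theorems.FreeSubtorusSubtorusCovering.subtorusCovering_proof` (g1-ValiantsHypothesis-16134).
-/

open Literature.Computability.AlgebraicComplexity
open Summit.ValiantsHypothesis.ValiantsHypothesis.Cruxes.OrbitDimensionBound.Confusion
open Summit.ValiantsHypothesis.ValiantsHypothesis.Cruxes.OrbitDimensionBound.Gauge
open Summit.ValiantsHypothesis.ValiantsHypothesis.Cruxes.OrbitDimensionBound.Depth

namespace Summit.ValiantsHypothesis.ValiantsHypothesis.Cruxes.OrbitDimensionBound.Depth.Special

/-- (a) BC5 RUNG / F3 WITNESS: the family member at the floor parameter `q = 0` is a THEOREM — it is the seed, transported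
through the lemma-level identification `depthCovering_zero_iff`. [cite: LandsbergRessayre2017, Thm. 2.8] -/
theorem FilteredCovering_special : DepthCovering 0 :=
  depthCovering_zero_iff.mpr
    Summit.ValiantsHypothesis.ValiantsHypothesis.Theorems.FreeSubtorusSubtorusCovering.subtorusCovering_proof

/-- (b) `q = 0` IS the floor, both directions, by name. [cite: LandsbergRessayre2017, Def. 1.3] -/
example : DepthCovering 0 ↔ Summit.ValiantsHypothesis.ValiantsHypothesis.Theses.FreeSubtorus.SubtorusCovering :=
  depthCovering_zero_iff

/-- (c) the shadow at the floor parameter is a theorem, and is gen 1's floor shadow. [folklore] -/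
example : DepthShadow 0 := depthShadow_zero
example : DepthShadow 0 ↔ CoveringShadow powLoss := depthShadow_zero_iff
example : DepthShadow 0 ↔ GaugeShadow 0 := depthShadow_zero_iff_gaugeShadow_zero

/-- (d) rung ⇒ floor, numeric and shadow forms (dial antitone in `q`). [folklore] -/
example (h : FilteredCovering) : Summit.ValiantsHypothesis.ValiantsHypothesis.Theses.FreeSubtorus.SubtorusCovering :=
  subtorusCovering_of_depthCovering h
example (h : FilteredShadow) : CoveringShadow powLoss := powShadow_of_filteredShadow h
example (h : PolystableCovering) : FilteredCovering := filteredCovering_of_polystableCovering h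
example {q q' : ℕ∞} (hq : q ≤ q') (h : DepthCovering q') : DepthCovering q := h.anti hq

/-- (e) the floor's hypothesis class sits inside the rung's: exact constant lifts are depth-`q` lifts for every `q`; and the
host crux implies the relaxed target. [cite: LandsbergRessayre2017, Def. 1.3] -/
example {n m : ℕ} {q : ℕ∞} (S : Set (GL (Fin n × Fin n) ℂ)) (A : Matrix (Fin m) (Fin m) (MvPolynomial (Fin n × Fin n) ℂ))
    (h : ∀ γ ∈ S, ∃ g h : GL (Fin m) ℂ, Matrix.linSubstEntries γ A =
      (g : Matrix (Fin m) (Fin m) ℂ).map MvPolynomial.C * A *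
        ((h⁻¹ : GL (Fin m) ℂ) : Matrix (Fin m) (Fin m) ℂ).map MvPolynomial.C) :
    DepthLifts q S A :=
  DepthLifts.of_exact h
example (h : Summit.ValiantsHypothesis.ValiantsHypothesis.Theses.FreeSubtorus.OrbitDimensionBound) : OrbitDepthBound 1 :=
  orbitDepthBound_of_orbitDimensionBound 1 h

/-- (f) the dial MOVES: already for `2 × 2` matrices the depth-`1` relation is strictly larger than the depth-`0` (gauge) relation
(`depth_one_toy`: `[[X,0],[1,X]] ⇝ [[X,0],[0,X]]` is a depth-`1` degeneration and not a gauge form). [cite: King1994, §2] -/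
example := depth_one_toy

/-- (g) the relaxed closings by name. [cite: LandsbergRessayre2017, Question 2.2] -/
example (h₁ : OrbitDepthBound 1) (h₂ : FilteredCovering) : _root_.ValiantsHypothesis := closes_filtered h₁ h₂
example (h₁ : Summit.ValiantsHypothesis.ValiantsHypothesis.Theses.FreeSubtorus.OrbitDimensionBound) :
    _root_.ValiantsHypothesis := closes_floor h₁

end Summit.ValiantsHypothesis.ValiantsHypothesis.Cruxes.OrbitDimensionBound.Depth.Special
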